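import Summits.ResolutionOfSingularities.ResolutionOfSingularities.Theorems.FrobeniusLadderFInjectiveMacaulayficationT4PlusFedderData
import Summits.ResolutionOfSingularities.ResolutionOfSingularities.Theorems.FrobeniusLadderFInjectiveMacaulayficationT4PlusStalkData
import Summits.ResolutionOfSingularities.ResolutionOfSingularities.Theorems.FrobeniusLadderFInjectiveMacaulayficationCIJacobian
import Mathlib.Algebra.MvPolynomial.PDeriv
import Mathlib.Tactic.LinearCombination
import HarnessLib

/-!
# `hoff` for `T⁽⁴⁾⁺`: the crux clause at every closed point of `V(Φ−y²−x³, z²+Φ³+w⁷+v⁸+x¹²) ⊂ 𝔸⁶` off the stratum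
# `V(x, Φ)`, `p = 7` (crux `FInjectiveMacaulayfication`, K-T4 at the deciding specimen `T⁽⁴⁾`, «T4plus hoff»)

Support file for crux stmt-ResolutionOfSingularities-15315 (`FrobeniusLadder.FInjectiveMacaulayfication`), chain w45a,
seat res-L1-w45a-stub-4 (res-L1-w45a-plan-1 R12.9 (b) «GO T4plus hoff», deliverable 2). [OURS · L1 W4.5a] — NOT a
statement of the manuscript [claim: Hironaka2017]; AI-written, weaker than expert review.

`F₁ = Φ − y² − x³`, `F₂ = z² + Φ³ + w⁷ + v⁸ + x¹²` in `k[x,y,z,w,v,Φ] = MvPolynomial (Fin 6) k` (this order, stub-6's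
`T4PlusPrime` convention), `char k = 7`, `X = V(F₁, F₂) ≅ V(T⁽⁴⁾)`, `T⁽⁴⁾ = z² + (y²+x³)³ + w⁷ + v⁸ + x¹²` (idea-1's key
re-embedding). MAIN THEOREM `t4Plus_hoff_char7`: the `hoff` binder of the c.i.-CN engine
`CIConeFiModelSmooth.ciConeFiModelRel_of_smoothFaceCertificates` (p507224) for `Fs = ![F₁, F₂]`, `J = {0, 5}` — at every
maximal ideal `Q` of `k[X]/(F₁,F₂)` missing `x̄` or `Φ̄` the local ring satisfies the per-stalk clause of the crux.

The `2 × 2` minors of `∂(F₁,F₂)/∂(x,y,z,w,v,Φ)` contain `−2z`, `−8v⁷`, `−6yΦ²`, `24x¹¹y` and `−9x²Φ² − 12x¹¹`; so off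
`V(x, Φ)` the only closed points at which the CI Jacobian criterion (`CIJacobian.ci_clause_of_det_not_mem`, stub-6) is
silent have `y, z, v ∈ P`, `x ∉ P`, `9x²Φ² + 12x¹¹ ∈ P` — in the residue field: `b_Φ = b_x³`, `b_x³ = 1`, `b_w⁷ = −2`
(§3), the three `𝔽₇`-points of the «singular circle». THERE the ring is a non-degenerate double point suspended by
`t⁷ + v⁸` and Fedder's criterion for the complete intersection applies with the witness of `T4PlusFedderData`
(`t4Plus_fedder_circle`, monomial `y⁶z⁶Φ⁶` of the translated `(F₁F₂)⁶`) through the residue-point dictionary (C3a) and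
stub-6's `CIFedderAtMaximalIdeal.ci_fedderAtMaximalIdeal`. ROAD A SURVIVES AT `T⁽⁴⁾`: the deciding specimen of K-T4 does
not kill the c.i.-CN engine's `hoff` hypothesis.

* §3 `residue_point_circle` (the algebra `b_x³ = 1`, `b_Φ = 1`, `b_w⁷ = −2` at a Jacobian-silent point), `fedder_at_circle`,
  `clause_circle` (Fedder regime, over `Ideal.span s`, `s = {r | r ∈ [F₁,F₂]}`; dimension binder and primality of `F₁` from
  `T4PlusStalkData` §1–§2);
* §4 `clause_of_minor` (any `(i,j)`-minor of `∂(Fs 0, Fs 1)` outside `P` gives the clause; the five minors are computed in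
  `T4PlusStalkData` §3), `units_char7`;
* §5 `t4Plus_hoff_char7` — the binder, over `Ideal.span (Set.range Fs)`, `Fs 0 = F₁`, `Fs 1 = F₂`;
* §6 `t4Plus_clause_off_origin` — the same clause at EVERY closed point other than the origin (`J = univ`): on
  `V(x, Φ) ∖ {0}` the minors `−2z`, `−8v⁷` suffice. So the bad locus of `T⁽⁴⁾⁺` is `⊆ {0}` (the form a specimen door needs).

No definitions, no named facts; glue. [cite: Fedder1983, Prop. 1.7, Thm. 1.12, Prop. 2.1; Matsumura1987, Thm. 30.4 (ii)]
-/

-- single-problem summit: the doubled namespace component is forced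
set_option linter.dupNamespace false

noncomputable section

namespace Summit.ResolutionOfSingularities.ResolutionOfSingularities.Theorems.FInjectiveMacaulayfication.T4PlusOffStratum

open MvPolynomial IsLocalRing Literature.RingTheory.TightClosure Literature.AlgebraicGeometry.Resolution
open Summit.ResolutionOfSingularities.ResolutionOfSingularities.Theorems.FInjectiveMacaulayfication
open ThreefoldG3Prime T4PlusStalkData


/-! ## §3 The Fedder regime: the singular circle `y, z, v ∈ P`, `x ∉ P`, `9x²Φ² + 12x¹¹ ∈ P` -/

section Fedder

variable {k : Type} [Field k] [CharP k 7]

/-- **The residue point of a Jacobian-silent closed point off `V(x, Φ)`**: in a field `K` of characteristic `7`, if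
`F₁(b) = F₂(b) = 0`, `b_y = b_z = b_v = 0`, `b_x ≠ 0` and the `(x,Φ)`-minor `9b_x²b_Φ² + 12b_x¹¹` vanishes, then
`b_x³ = 1`, `b_Φ = 1`, `b_w⁷ = −2`. [folklore] -/
theorem residue_point_circle {K : Type} [Field K] [CharP K 7] (b : Fin 6 → K)
    (hF₁ : b 5 - b 1 ^ 2 - b 0 ^ 3 = 0) (hF₂ : b 2 ^ 2 + b 5 ^ 3 + b 3 ^ 7 + b 4 ^ 8 + b 0 ^ 12 = 0)
    (h1 : b 1 = 0) (h2 : b 2 = 0) (h4 : b 4 = 0) (hx : b 0 ≠ 0)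
    (hdet : 9 * b 0 ^ 2 * b 5 ^ 2 + 12 * b 0 ^ 11 = 0) :
    b 0 ^ 3 = 1 ∧ b 5 = 1 ∧ b 3 ^ 7 = -2 := by
  have h7 : (7 : K) = 0 := by
    have h : ((7 : ℕ) : K) = 0 := CharP.cast_eq_zero K 7
    exact_mod_cast h
  have h5 : b 5 = b 0 ^ 3 := by linear_combination hF₁ + b 1 * h1
  have hprod : b 0 ^ 8 * (9 + 12 * b 0 ^ 3) = 0 := by
    linear_combination hdet - 9 * b 0 ^ 2 * (b 5 + b 0 ^ 3) * h5
  have hlin : 9 + 12 * b 0 ^ 3 = 0 := by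
    rcases mul_eq_zero.mp hprod with h | h
    · exact absurd (pow_eq_zero_iff (by norm_num) |>.mp h) hx
    · exact h
  have hx3 : b 0 ^ 3 = 1 := by linear_combination 3 * hlin - (5 * b 0 ^ 3 + 4) * h7
  have h5' : b 5 = 1 := by rw [h5, hx3]
  refine ⟨hx3, h5', ?_⟩
  linear_combination hF₂ - b 2 * h2 - b 4 ^ 7 * h4 - (b 5 ^ 2 + b 5 + 1) * h5' - (b 0 ^ 9 + b 0 ^ 6 + b 0 ^ 3 + 1) * hx3

/-- **`(F₁F₂)⁶ ∉ P^[7]` at every maximal ideal `P ⊇ (F₁, F₂)` of `k[X]` on the singular circle** (`y, z, v ∈ P`, `x ∉ P`,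
`9x²Φ² + 12x¹¹ ∈ P`): the residue point satisfies `b_x³ = 1`, `b_Φ = 1`, `b_w⁷ = −2` (`residue_point_circle`), so
`T4PlusFedderData.t4Plus_fedder_circle` + the residue-point dictionary (C3a) apply. [cite: Fedder1983, Prop. 1.7 and
Prop. 2.1] -/
theorem fedder_at_circle (F₁ F₂ : MvPolynomial (Fin 6) k)
    (hF₁ : F₁ = X 5 - X 1 ^ 2 - X 0 ^ 3) (hF₂ : F₂ = X 2 ^ 2 + X 5 ^ 3 + X 3 ^ 7 + X 4 ^ 8 + X 0 ^ 12)
    (P : Ideal (MvPolynomial (Fin 6) k)) [P.IsMaximal] (hF₁P : F₁ ∈ P) (hF₂P : F₂ ∈ P)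
    (h1 : (X 1 : MvPolynomial (Fin 6) k) ∈ P) (h2 : (X 2 : MvPolynomial (Fin 6) k) ∈ P)
    (h4 : (X 4 : MvPolynomial (Fin 6) k) ∈ P) (hx : (X 0 : MvPolynomial (Fin 6) k) ∉ P)
    (hdet : (9 * X 0 ^ 2 * X 5 ^ 2 + 12 * X 0 ^ 11 : MvPolynomial (Fin 6) k) ∈ P) :
    (F₁ * F₂) ^ (7 - 1) ∉ frobeniusPower 7 P := by
  haveI : Fact (Nat.Prime 7) := ⟨by norm_num⟩
  letI : Field (MvPolynomial (Fin 6) k ⧸ P) := Ideal.Quotient.field P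
  haveI : CharP (MvPolynomial (Fin 6) k ⧸ P) 7 :=
    charP_of_injective_algebraMap (algebraMap k (MvPolynomial (Fin 6) k ⧸ P)).injective 7
  set b : Fin 6 → MvPolynomial (Fin 6) k ⧸ P := fun i => Ideal.Quotient.mk P (X i) with hb
  have hev : ∀ q : MvPolynomial (Fin 6) k, Ideal.Quotient.mk P q = MvPolynomial.aeval b q := fun q => by
    have h : (Ideal.Quotient.mkₐ k P : MvPolynomial (Fin 6) k →ₐ[k] MvPolynomial (Fin 6) k ⧸ P) = MvPolynomial.aeval b :=
      MvPolynomial.algHom_ext fun i => by rw [MvPolynomial.aeval_X]; rfl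
    exact DFunLike.congr_fun h q
  have hz : ∀ q : MvPolynomial (Fin 6) k, q ∈ P → MvPolynomial.aeval b q = 0 := fun q hq => by
    rw [← hev, Ideal.Quotient.eq_zero_iff_mem]
    exact hq
  have e1 : b 5 - b 1 ^ 2 - b 0 ^ 3 = 0 := by simpa [hF₁] using hz F₁ hF₁P
  have e2 : b 2 ^ 2 + b 5 ^ 3 + b 3 ^ 7 + b 4 ^ 8 + b 0 ^ 12 = 0 := by simpa [hF₂] using hz F₂ hF₂P
  have eb1 : b 1 = 0 := by simpa using hz (X 1) h1
  have eb2 : b 2 = 0 := by simpa using hz (X 2) h2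
  have eb4 : b 4 = 0 := by simpa using hz (X 4) h4
  have ebx : b 0 ≠ 0 := fun h => hx (by rw [← Ideal.Quotient.eq_zero_iff_mem]; exact h)
  have edet : 9 * b 0 ^ 2 * b 5 ^ 2 + 12 * b 0 ^ 11 = 0 := by simpa using hz _ hdet
  obtain ⟨hx3, h5, hw⟩ := residue_point_circle b e1 e2 eb1 eb2 eb4 ebx edet
  exact FrobeniusPowerOfFedderAt.frobeniusPower_of_fedderAt 7 k 6 (F₁ * F₂) P
    (T4PlusFedderData.t4Plus_fedder_circle F₁ F₂ hF₁ hF₂ b eb1 eb2 eb4 hx3 h5 hw)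

/-- **The clause at a closed point of the singular circle** (Fedder for the complete intersection, stub-6's
`CIFedderAtMaximalIdeal.ci_fedderAtMaximalIdeal`), stated over `Ideal.span s` for the presentation `s = {r | r ∈ [F₁, F₂]}`.
[cite: Fedder1983, Prop. 1.7, Thm. 1.12 and Prop. 2.1] -/
theorem clause_circle (F₁ F₂ : MvPolynomial (Fin 6) k)
    (hF₁ : F₁ = X 5 - X 1 ^ 2 - X 0 ^ 3) (hF₂ : F₂ = X 2 ^ 2 + X 5 ^ 3 + X 3 ^ 7 + X 4 ^ 8 + X 0 ^ 12)
    (s : Set (MvPolynomial (Fin 6) k)) (hs : s = {r : MvPolynomial (Fin 6) k | r ∈ [F₁, F₂]}) :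
    ∀ (Q : Ideal (MvPolynomial (Fin 6) k ⧸ Ideal.span s)) [Q.IsMaximal],
      (X 1 : MvPolynomial (Fin 6) k) ∈ Q.comap (Ideal.Quotient.mk (Ideal.span s)) →
      (X 2 : MvPolynomial (Fin 6) k) ∈ Q.comap (Ideal.Quotient.mk (Ideal.span s)) →
      (X 4 : MvPolynomial (Fin 6) k) ∈ Q.comap (Ideal.Quotient.mk (Ideal.span s)) →
      (X 0 : MvPolynomial (Fin 6) k) ∉ Q.comap (Ideal.Quotient.mk (Ideal.span s)) →
      (9 * X 0 ^ 2 * X 5 ^ 2 + 12 * X 0 ^ 11 : MvPolynomial (Fin 6) k) ∈ Q.comap (Ideal.Quotient.mk (Ideal.span s)) →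
      ∀ d : ℕ, ringKrullDim (Localization.AtPrime Q) = d → ∀ sq : Fin d → Localization.AtPrime Q,
        (Ideal.span (Set.range sq)).radical.IsMaximal →
          RingTheory.Sequence.IsWeaklyRegular (Localization.AtPrime Q) (List.ofFn sq) ∧
          ∀ y : Localization.AtPrime Q, (∃ e : ℕ, y ^ 7 ^ e ∈ Ideal.span
            ((fun z : Localization.AtPrime Q => z ^ 7 ^ e) ''
              (Ideal.span (Set.range sq) : Set (Localization.AtPrime Q)))) → y ∈ Ideal.span (Set.range sq) := by
  subst hs
  intro Q _ h1 h2 h4 hx hdet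
  haveI : Fact (Nat.Prime 7) := ⟨by norm_num⟩
  haveI hPmax : (Q.comap (Ideal.Quotient.mk (Ideal.ofList [F₁, F₂]))).IsMaximal :=
    Ideal.comap_isMaximal_of_surjective _ Ideal.Quotient.mk_surjective
  have hsub : Ideal.ofList [F₁, F₂] ≤ Q.comap (Ideal.Quotient.mk (Ideal.ofList [F₁, F₂])) := fun r hr => by
    rw [Ideal.mem_comap, Ideal.Quotient.eq_zero_iff_mem.mpr hr]
    exact Q.zero_mem
  have hF₁P : F₁ ∈ Q.comap (Ideal.Quotient.mk (Ideal.ofList [F₁, F₂])) := hsub (Ideal.subset_span (by simp))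
  have hF₂P : F₂ ∈ Q.comap (Ideal.Quotient.mk (Ideal.ofList [F₁, F₂])) := hsub (Ideal.subset_span (by simp))
  obtain ⟨m, a, ha⟩ := Submodule.fg_iff_exists_fin_generating_family.mp
    (IsNoetherian.noetherian (Q.comap (Ideal.Quotient.mk (Ideal.ofList [F₁, F₂]))))
  have hfedP := fedder_at_circle F₁ F₂ hF₁ hF₂ (Q.comap (Ideal.Quotient.mk (Ideal.ofList [F₁, F₂]))) hF₁P hF₂P h1 h2 h4 hx
    hdet
  have hfed : [F₁, F₂].prod ^ (7 - 1) ∉ Ideal.span (Set.range fun i : Fin m => a i ^ 7) := by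
    intro h
    apply hfedP
    have hle : Ideal.span (Set.range fun i : Fin m => a i ^ 7) ≤
        frobeniusPower 7 (Q.comap (Ideal.Quotient.mk (Ideal.ofList [F₁, F₂]))) := by
      rw [Ideal.span_le]
      rintro _ ⟨i, rfl⟩
      have hai : a i ∈ Q.comap (Ideal.Quotient.mk (Ideal.ofList [F₁, F₂])) := by
        rw [← ha]
        exact Submodule.subset_span ⟨i, rfl⟩
      exact pow_mem_frobeniusPower hai
    have hprod : [F₁, F₂].prod = F₁ * F₂ := by simp
    rw [hprod] at h
    exact hle h
  exact CIFedderAtMaximalIdeal.ci_fedderAtMaximalIdeal k 6 m 7 a [F₁, F₂] Q ha.symm hfed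
    (ringKrullDim_stalk_add_two F₁ F₂ hF₁ hF₂ Q)

end Fedder


section Jacobian

variable {k : Type} [Field k] [CharP k 7]

/-- **The clause from one `2 × 2` minor of the Jacobian** (stub-6's `CIJacobian.ci_clause_of_det_not_mem` with the derivations
`∂ᵢ, ∂ⱼ`): if `∂ᵢ(Fs 0)·∂ⱼ(Fs 1) − ∂ᵢ(Fs 1)·∂ⱼ(Fs 0) ∉ P` then the local ring at `Q` is regular and satisfies the clause.
[cite: Matsumura1987, Thm. 30.4 (ii)] -/
theorem clause_of_minor (Fs : Fin 2 → MvPolynomial (Fin 6) k)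
    (Q : Ideal (MvPolynomial (Fin 6) k ⧸ Ideal.span (Set.range Fs))) [Q.IsPrime] (i j : Fin 6)
    (hm : pderiv i (Fs 0) * pderiv j (Fs 1) - pderiv i (Fs 1) * pderiv j (Fs 0) ∉
      Q.comap (Ideal.Quotient.mk (Ideal.span (Set.range Fs)))) :
    ∀ d : ℕ, ringKrullDim (Localization.AtPrime Q) = d → ∀ sq : Fin d → Localization.AtPrime Q,
      (Ideal.span (Set.range sq)).radical.IsMaximal →
        RingTheory.Sequence.IsWeaklyRegular (Localization.AtPrime Q) (List.ofFn sq) ∧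
        ∀ y : Localization.AtPrime Q, (∃ e : ℕ, y ^ 7 ^ e ∈ Ideal.span
          ((fun z : Localization.AtPrime Q => z ^ 7 ^ e) ''
            (Ideal.span (Set.range sq) : Set (Localization.AtPrime Q)))) → y ∈ Ideal.span (Set.range sq) := by
  haveI : Fact (Nat.Prime 7) := ⟨by norm_num⟩
  let D : Fin 2 → Derivation ℤ (MvPolynomial (Fin 6) k) (MvPolynomial (Fin 6) k) :=
    ![(pderiv i).restrictScalars ℤ, (pderiv j).restrictScalars ℤ]
  have hdet : (Matrix.of fun a c => D a (Fs c)).det = pderiv i (Fs 0) * pderiv j (Fs 1) - pderiv i (Fs 1) * pderiv j (Fs 0) := by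
    rw [Matrix.det_fin_two]
    simp only [D, Matrix.of_apply, Matrix.cons_val_zero, Matrix.cons_val_one, Derivation.restrictScalars_apply]
  have hndet : (Matrix.of fun a c => D a (Fs c)).det ∉ Q.comap (Ideal.Quotient.mk (Ideal.span (Set.range Fs))) := by
    rw [hdet]
    exact hm
  exact (CIJacobian.ci_clause_of_det_not_mem 7 k 6 2 Fs Q D hndet).2.2.1

/-- The non-zero residues `−2, −8, −6, 24` modulo `7`, as elements of `k`. [folklore] -/
theorem units_char7 : (-2 : k) ≠ 0 ∧ (-8 : k) ≠ 0 ∧ (-6 : k) ≠ 0 ∧ (24 : k) ≠ 0 := by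
  have hnat : ∀ n : ℕ, ¬ 7 ∣ n → (n : k) ≠ 0 := fun n hn h => hn ((CharP.cast_eq_zero_iff k 7 n).mp h)
  refine ⟨?_, ?_, ?_, ?_⟩
  · have h := hnat 2 (by omega)
    intro h'; exact h (by exact_mod_cast neg_eq_zero.mp h')
  · have h := hnat 8 (by omega)
    intro h'; exact h (by exact_mod_cast neg_eq_zero.mp h')
  · have h := hnat 6 (by omega)
    intro h'; exact h (by exact_mod_cast neg_eq_zero.mp h')
  · have h := hnat 24 (by omega)
    exact_mod_cast h

end Jacobian

/-! ## §5 The `hoff` binder of the c.i.-CN engine for `T⁽⁴⁾⁺`, `J = {0, 5}` -/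

/-- **`hoff` FOR `T⁽⁴⁾⁺`, `char k = 7`** — the hypothesis `hoff` of `CIConeFiModelSmooth.ciConeFiModelRel_of_smoothFaceCertificates`
for a family `Fs : Fin 2 → k[x,y,z,w,v,Φ]` with `Fs 0 = Φ − y² − x³`, `Fs 1 = z² + Φ³ + w⁷ + v⁸ + x¹²` (the shape of
`T4PlusPrime.t4plus_prime_and_X_ne_zero`) and `J = {0, 5}`: at every maximal ideal of `k[X]/(Fs)` missing `x̄` or `Φ̄` the
local ring satisfies the per-stalk clause of crux `FInjectiveMacaulayfication`. Regimes: the Jacobian minors `−2z`, `−8v⁷`,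
`−6yΦ²` (`y, Φ ∉ P`), `24x¹¹y` (`y ∉ P`, `Φ ∈ P`, so `x ∉ P`), `−(9x²Φ²+12x¹¹)`; and Fedder at the singular circle
(`clause_circle`). **K-T4's deciding specimen `T⁽⁴⁾` does not kill road A.** [cite: Fedder1983, Prop. 2.1; Matsumura1987,
Thm. 30.4 (ii)] -/
theorem t4Plus_hoff_char7 (k : Type) [Field k] [CharP k 7] (Fs : Fin 2 → MvPolynomial (Fin 6) k)
    (hF₀ : Fs 0 = X 5 - X 1 ^ 2 - X 0 ^ 3) (hF₁ : Fs 1 = X 2 ^ 2 + X 5 ^ 3 + X 3 ^ 7 + X 4 ^ 8 + X 0 ^ 12) :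
    ∀ (Q : Ideal (MvPolynomial (Fin 6) k ⧸ Ideal.span (Set.range Fs))) [Q.IsMaximal],
      (∃ j ∈ ({0, 5} : Finset (Fin 6)), Ideal.Quotient.mk (Ideal.span (Set.range Fs)) (MvPolynomial.X j) ∉ Q) →
      ∀ dd : ℕ, ringKrullDim (Localization.AtPrime Q) = dd → ∀ s : Fin dd → Localization.AtPrime Q,
        (Ideal.span (Set.range s)).radical.IsMaximal →
          RingTheory.Sequence.IsWeaklyRegular (Localization.AtPrime Q) (List.ofFn s) ∧
          ∀ y : Localization.AtPrime Q, (∃ e : ℕ, y ^ 7 ^ e ∈ Ideal.span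
            ((fun z : Localization.AtPrime Q => z ^ 7 ^ e) ''
              (Ideal.span (Set.range s) : Set (Localization.AtPrime Q)))) → y ∈ Ideal.span (Set.range s) := by
  intro Q _ hj
  obtain ⟨u2, u8, u6, u24⟩ := units_char7 (k := k)
  have mz := minor_zP Fs hF₀ hF₁
  have mv := minor_vP Fs hF₀ hF₁
  have my := minor_yP Fs hF₀ hF₁
  have mxy := minor_xy Fs hF₀ hF₁
  have mxP := minor_xP Fs hF₀ hF₁
  set P := Q.comap (Ideal.Quotient.mk (Ideal.span (Set.range Fs))) with hPdef
  haveI : P.IsPrime := Ideal.comap_isPrime _ _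
  have hF₀P : Fs 0 ∈ P := by
    rw [hPdef, Ideal.mem_comap, Ideal.Quotient.eq_zero_iff_mem.mpr (Ideal.subset_span (Set.mem_range_self 0))]
    exact Q.zero_mem
  -- off the stratum: `x ∉ P` or `Φ ∉ P`
  have hoff : (X 0 : MvPolynomial (Fin 6) k) ∉ P ∨ (X 5 : MvPolynomial (Fin 6) k) ∉ P := by
    obtain ⟨j, hj, hjQ⟩ := hj
    simp only [Finset.mem_insert, Finset.mem_singleton] at hj
    rcases hj with rfl | rfl
    · exact Or.inl fun h => hjQ (Ideal.mem_comap.mp h)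
    · exact Or.inr fun h => hjQ (Ideal.mem_comap.mp h)
  by_cases hz : (X 2 : MvPolynomial (Fin 6) k) ∈ P
  swap
  · exact clause_of_minor Fs Q 2 5 (by rw [mz]; exact C_mul_not_mem u2 hz)
  by_cases hv : (X 4 : MvPolynomial (Fin 6) k) ∈ P
  swap
  · exact clause_of_minor Fs Q 4 5 (by rw [mv]; exact C_mul_not_mem u8 fun h => hv (Ideal.IsPrime.mem_of_pow_mem ‹P.IsPrime› 7 h))
  by_cases hy : (X 1 : MvPolynomial (Fin 6) k) ∈ P
  · -- `y ∈ P`: then `Φ − x³ ∈ P`, so `x ∉ P`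
    have hx : (X 0 : MvPolynomial (Fin 6) k) ∉ P := by
      rcases hoff with h | h
      · exact h
      · intro hx
        apply h
        have e : (X 5 : MvPolynomial (Fin 6) k) = Fs 0 + X 1 * X 1 + X 0 * X 0 ^ 2 := by rw [hF₀]; ring
        rw [e]
        exact add_mem (add_mem hF₀P (Ideal.mul_mem_right _ _ hy)) (Ideal.mul_mem_right _ _ hx)
    by_cases hd : (9 * X 0 ^ 2 * X 5 ^ 2 + 12 * X 0 ^ 11 : MvPolynomial (Fin 6) k) ∈ P
    · -- the singular circle: Fedder
      have hrange : Set.range Fs = {r : MvPolynomial (Fin 6) k | r ∈ [Fs 0, Fs 1]} := by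
        ext r
        simp only [Set.mem_range, Set.mem_setOf_eq, List.mem_cons, List.not_mem_nil, or_false]
        constructor
        · rintro ⟨i, rfl⟩
          fin_cases i <;> simp
        · rintro (h | h)
          · exact ⟨0, h.symm⟩
          · exact ⟨1, h.symm⟩
      exact clause_circle (Fs 0) (Fs 1) hF₀ hF₁ (Set.range Fs) hrange Q hy hz hv hx hd
    · exact clause_of_minor Fs Q 0 5 (by rw [mxP]; exact C_mul_not_mem (by norm_num) hd)
  · by_cases hP5 : (X 5 : MvPolynomial (Fin 6) k) ∈ P
    · -- `Φ ∈ P`: then `x ∉ P`; minor `(x,y)`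
      have hx : (X 0 : MvPolynomial (Fin 6) k) ∉ P := by
        rcases hoff with h | h
        · exact h
        · exact absurd hP5 h
      refine clause_of_minor Fs Q 0 1 ?_
      rw [mxy]
      refine C_mul_not_mem u24 fun h => ?_
      rcases Ideal.IsPrime.mem_or_mem ‹P.IsPrime› h with h1 | h1
      · exact hx (Ideal.IsPrime.mem_of_pow_mem ‹P.IsPrime› 11 h1)
      · exact hy h1
    · -- `y, Φ ∉ P`: minor `(y,Φ)`
      refine clause_of_minor Fs Q 1 5 ?_
      rw [my]
      refine C_mul_not_mem u6 fun h => ?_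
      rcases Ideal.IsPrime.mem_or_mem ‹P.IsPrime› h with h1 | h1
      · exact hy h1
      · exact hP5 (Ideal.IsPrime.mem_of_pow_mem ‹P.IsPrime› 2 h1)

/-! ## §6 The clause at EVERY closed point of `T⁽⁴⁾⁺` other than the origin -/

/-- **THE ONLY POSSIBLY BAD CLOSED POINT OF `T⁽⁴⁾⁺` IS THE ORIGIN (`char k = 7`).** At every maximal ideal of `k[X]/(Fs)`
missing SOME `x̄ⱼ` (`j : Fin 6` arbitrary — `J = univ`, the point-supported form road B and a specimen door want) the local
ring satisfies the per-stalk clause: off `V(x, Φ)` this is `t4Plus_hoff_char7`; on `V(x, Φ) ∖ {0}` one has `y ∈ P`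
(`y² = Φ − x³ − F₁`), so `z ∉ P` or `v ∉ P` (else `w⁷ = F₂ − z² − Φ³ − v⁸ − x¹² ∈ P` and `P ∋` every variable) and the minors
`−2z`, `−8v⁷` give regularity. [cite: Fedder1983, Prop. 2.1; Matsumura1987, Thm. 30.4 (ii)] -/
theorem t4Plus_clause_off_origin (k : Type) [Field k] [CharP k 7] (Fs : Fin 2 → MvPolynomial (Fin 6) k)
    (hF₀ : Fs 0 = X 5 - X 1 ^ 2 - X 0 ^ 3) (hF₁ : Fs 1 = X 2 ^ 2 + X 5 ^ 3 + X 3 ^ 7 + X 4 ^ 8 + X 0 ^ 12) :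
    ∀ (Q : Ideal (MvPolynomial (Fin 6) k ⧸ Ideal.span (Set.range Fs))) [Q.IsMaximal],
      (∃ j : Fin 6, Ideal.Quotient.mk (Ideal.span (Set.range Fs)) (MvPolynomial.X j) ∉ Q) →
      ∀ dd : ℕ, ringKrullDim (Localization.AtPrime Q) = dd → ∀ s : Fin dd → Localization.AtPrime Q,
        (Ideal.span (Set.range s)).radical.IsMaximal →
          RingTheory.Sequence.IsWeaklyRegular (Localization.AtPrime Q) (List.ofFn s) ∧
          ∀ y : Localization.AtPrime Q, (∃ e : ℕ, y ^ 7 ^ e ∈ Ideal.span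
            ((fun z : Localization.AtPrime Q => z ^ 7 ^ e) ''
              (Ideal.span (Set.range s) : Set (Localization.AtPrime Q)))) → y ∈ Ideal.span (Set.range s) := by
  intro Q _ hj
  obtain ⟨u2, u8, -, -⟩ := units_char7 (k := k)
  have mz := minor_zP Fs hF₀ hF₁
  have mv := minor_vP Fs hF₀ hF₁
  set P := Q.comap (Ideal.Quotient.mk (Ideal.span (Set.range Fs))) with hPdef
  haveI : P.IsPrime := Ideal.comap_isPrime _ _
  have hFP : ∀ l : Fin 2, Fs l ∈ P := fun l => by
    rw [hPdef, Ideal.mem_comap, Ideal.Quotient.eq_zero_iff_mem.mpr (Ideal.subset_span (Set.mem_range_self l))]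
    exact Q.zero_mem
  by_cases hoff : (X 0 : MvPolynomial (Fin 6) k) ∉ P ∨ (X 5 : MvPolynomial (Fin 6) k) ∉ P
  · refine t4Plus_hoff_char7 k Fs hF₀ hF₁ Q ?_
    rcases hoff with h | h
    · exact ⟨0, by simp, fun h' => h (Ideal.mem_comap.mpr h')⟩
    · exact ⟨5, by simp, fun h' => h (Ideal.mem_comap.mpr h')⟩
  rw [not_or, not_not, not_not] at hoff
  obtain ⟨hx, hP5⟩ := hoff
  by_cases hz : (X 2 : MvPolynomial (Fin 6) k) ∈ P
  swap
  · exact clause_of_minor Fs Q 2 5 (by rw [mz]; exact C_mul_not_mem u2 hz)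
  by_cases hv : (X 4 : MvPolynomial (Fin 6) k) ∈ P
  swap
  · exact clause_of_minor Fs Q 4 5 (by rw [mv]; exact C_mul_not_mem u8 fun h => hv (Ideal.IsPrime.mem_of_pow_mem ‹P.IsPrime› 7 h))
  -- `x, Φ, z, v ∈ P` forces `y, w ∈ P`: no variable is missing
  exfalso
  have hy : (X 1 : MvPolynomial (Fin 6) k) ∈ P := by
    refine Ideal.IsPrime.mem_of_pow_mem ‹P.IsPrime› 2 ?_
    have e : (X 1 : MvPolynomial (Fin 6) k) ^ 2 = X 5 - X 0 * X 0 ^ 2 - Fs 0 := by rw [hF₀]; ring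
    rw [e]
    exact sub_mem (sub_mem hP5 (Ideal.mul_mem_right _ _ hx)) (hFP 0)
  have hw : (X 3 : MvPolynomial (Fin 6) k) ∈ P := by
    refine Ideal.IsPrime.mem_of_pow_mem ‹P.IsPrime› 7 ?_
    have e : (X 3 : MvPolynomial (Fin 6) k) ^ 7 = Fs 1 - X 2 * X 2 - X 5 * X 5 ^ 2 - X 4 * X 4 ^ 7 - X 0 * X 0 ^ 11 := by
      rw [hF₁]; ring
    rw [e]
    exact sub_mem (sub_mem (sub_mem (sub_mem (hFP 1) (Ideal.mul_mem_right _ _ hz)) (Ideal.mul_mem_right _ _ hP5))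
      (Ideal.mul_mem_right _ _ hv)) (Ideal.mul_mem_right _ _ hx)
  obtain ⟨j, hjQ⟩ := hj
  apply hjQ
  refine Ideal.mem_comap.mp (show (X j : MvPolynomial (Fin 6) k) ∈ P from ?_)
  fin_cases j
  · exact hx
  · exact hy
  · exact hz
  · exact hw
  · exact hv
  · exact hP5

end Summit.ResolutionOfSingularities.ResolutionOfSingularities.Theorems.FInjectiveMacaulayfication.T4PlusOffStratum

end
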